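import Summits.CriticalPhenomena.CardyFormulaZ2.Theses.CardyMeckeFlip
import Summits.CriticalPhenomena.CardyFormulaZ2.Theorems.CardyMeckeFlipMeckeRigidityDichotomy

/-!
# Birth skeleton (BC3) for crux `MeckeRigidity` (stmt-CriticalPhenomena-14826)

Route `CardyMeckeFlip` (sub-problem `CriticalPhenomena/CardyFormulaZ2`, rank-4 crux, card K2).  The crux, BY
NAME: `Summit.CriticalPhenomena.CardyFormulaZ2.Theses.CardyMeckeFlip.MeckeRigidity` — for every characterised
pivotal predicate `Piv` (`∀ S x Q, Piv S x Q ↔ …`, i.e. `Piv = QuadConfig.IsPivotalAt`), every probability law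
`P` on the Schramm–Smirnov space `ℋ_ℂ = QuadConfig univ` and every kernel family `M : ℝ → ℋ_ℂ → Measure ℂ`
satisfying (E2) isometry invariance, (D) exact self-duality on crossing cylinders, (RSW) the 3:1 lower bound,
(ADM) admissibility + isometry-equivariance, (F) flip-fairness of every `M ε`, (EXT) flip-extremality, give every
quad of a conformal rectangle its Cardy value `F(crossRatio x)`.

THE CUT (reshape 2 by lead c3, 2026-08-17, after landing the SIMILARITY-COVARIANCE package — every clause of the
axiom system transports under plane dilations `S_t` with the rescaled kernel family `M^t ε S = (t·)_* M (ε/t) (S_{t⁻¹} S)`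
(Theorems/CardyMeckeFlipMeckeRigidityDilation{API,Conjugation,Pivotal,SelfDual,RSW,FlipFair,Covariance}.lean), whence
(i) a model is EQUAL OR SINGULAR to each of its dilates, (ii) reshape-1's load-bearing stub `stub_notMutuallySingular`
IMPLIES that every model is scale-invariant (`scaleInvariant_of_notMutuallySingular`), (iii) the scale trichotomy
(Theorems/…ScaleStabiliser.lean: closed log-scale stabiliser = ℝ or cyclic, dilates off it singular).  Reshape 2 splits
reshape-1's stub ALONG THE TRICHOTOMY into two stubs, each implied by it:

* `stub_scaleInvariant` (LOAD-BEARING, open): every pair `(P, M)` satisfying the six clauses ((E2), (D), (RSW ∃c),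
  (ADM)+equivariance, (F) ∀ε, (EXT)) is SCALE-INVARIANT, `(S_t)_* P = P` for all `t > 0` — by the trichotomy it is
  the exclusion of the cyclic/trivial stabiliser, i.e. exactly where (D)+(RSW) must act ("a self-dual RSW law has no
  scale"); it is the abstract form of the scale-invariance crux of the sibling rigidity routes (ScaleInvariantLimits /
  CardyScaleErgodic) and is implied by reshape-1's stub (landed).
* `stub_notMutuallySingular_scaleInv` (LOAD-BEARING, open-problem): two SCALE-INVARIANT models of the six clauses are
  not mutually singular (= reshape-1's stub restricted to scale-invariant pairs; by the dichotomy p152331 equivalent to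
  their equality: stationary-law uniqueness among scale-invariant laws — the refuters' tilted-FK(q) objection to the
  kernel-parametric (F) lands HERE, both CLE₆ and CLE_{16/3} being scale-invariant).
* `stub_cardyModel` (unchanged): SOME pair `(P₀, M₀)` satisfies all six clauses AND has Cardy values (intended:
  the site-𝕋 / CLE₆ quad-crossing law with the GPS pivotal measures; (EXT) = ergodicity of continuum dynamical
  percolation, OPEN, GPS 2018 §12.1; blocked in tree on `Literature.Probability.Percolation.exists_isFullPlaneCNLLaw`
  + a loops→quads bridge).

Assembly `MeckeRigidity_of : stub_scaleInvariant → stub_notMutuallySingular_scaleInv → stub_cardyModel → MeckeRigidity`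
(sorry-free): identify `Piv` with `IsPivotalAt`, rebundle (ADM)/(F)/(EXT), take the Cardy model `(P₀, M₀)`, get scale
invariance of BOTH `P` and `P₀` from `stub_scaleInvariant`, apply the landed dichotomy to `(P, P₀)`: singularity is
excluded by `stub_notMutuallySingular_scaleInv`, so `P = P₀` and the crossing values of `P` are Cardy's.  Registered-stub device as before (`protected theorem Holds.stub_<name>` + `def stub_<name> : Prop :=
type_of% …`); the ONLY `sorry`s of this file are the three `Holds.stub_*`.  Landed support of the line (all
`--supports stmt-CriticalPhenomena-14826`, namespace `…Theorems.CardyMeckeFlip`): c1 — CrossingHalf (sum rule,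
P(square) = 1/2), CrossingContinuity (shape dependence, continuity, dense uniqueness), CampbellIntensity
(intensity = c·Leb); c2 — PivotalCarrier, PivotalSection, CampbellIntegrand, CylinderLocality, FlipExtremalConst,
ToggledIntegrand ((F) self-certifies measurability), FarCylinder (tail triviality), TranslationErgodic (Birkhoff on
cylinders), CylinderApprox, Ergodic (every translation ergodic), PivotalBalance (one-quad content of (F)),
Dichotomy; c3 — DilationAPI, DilationConjugation, DilationPivotal, DilationSelfDual, DilationRSW, DilationFlipFair,
DilationCovariance ((EXT)/(E2)/equivariance/(ADM) transport, equal-or-singular to dilates, stub ⟹ scale invariance),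
CylinderContinuity (joint continuity of cylinder probabilities under (D)), ScaleStabiliser (closed stabiliser, scale
trichotomy).
-/

noncomputable section

open MeasureTheory Set Filter Topology
open Literature.Probability.Percolation Literature.Probability.Percolation.QuadCrossing

namespace Summit.CriticalPhenomena.CardyFormulaZ2.Cruxes.MeckeRigidity.Birth

/-! ### The registered stubs (the ONLY `sorry`s of this file) -/

/-- STUB 1 (load-bearing, open; reshape 2, the "no scale" half of reshape-1's `stub_notMutuallySingular`) —
**every model is scale-invariant**: a probability law on `ℋ_ℂ` with (E2), (D), (RSW), an admissible
isometry-equivariant kernel family, (F) at every cutoff and (EXT) is invariant under every dilation `S_t`, `t > 0`.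
By the landed scale trichotomy it is the exclusion of a cyclic or trivial scale stabiliser (off which the dilates are
mutually singular); implied by reshape-1's stub (`scaleInvariant_of_notMutuallySingular`). [cite: GarbanPeteSchramm2018, §7.1 and §11.1 (cut-off flip dynamics); SchrammSmirnov2011, §1.4 (scaling S_t)] -/
protected theorem Holds.stub_scaleInvariant :
    ∀ (P : Measure (QuadConfig (Set.univ : Set ℂ))) (M : ℝ → QuadConfig (Set.univ : Set ℂ) → Measure ℂ),
      IsProbabilityMeasure P →
      (∀ g : ℂ ≃ᵢ ℂ, Measure.map (QuadConfig.isometry g) P = P) →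
      (∀ (n : ℕ) (Q Qt : Fin n → Quad (Set.univ : Set ℂ)),
        (∀ i, (Qt i).carrier = (Q i).carrier ∧ (Qt i).side 0 = (Q i).side 1 ∧
          (Qt i).side 1 = (Q i).side 2 ∧ (Qt i).side 2 = (Q i).side 3 ∧ (Qt i).side 3 = (Q i).side 0) →
        ∀ A : Set (Set (Fin n)), P {S | {i | Q i ∈ S} ∈ A} = P {S | {i | Qt i ∉ S} ∈ A}) →
      (∃ c : ℝ, 0 < c ∧ ∀ (a x y : ℝ), 0 < a → ∀ Q : Quad (Set.univ : Set ℂ),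
        Q.carrier = {w : ℂ | x ≤ w.re ∧ w.re ≤ x + 3 * a ∧ y ≤ w.im ∧ w.im ≤ y + a} →
        Q.side 0 = {w : ℂ | w.re = x ∧ y ≤ w.im ∧ w.im ≤ y + a} →
        Q.side 2 = {w : ℂ | w.re = x + 3 * a ∧ y ≤ w.im ∧ w.im ≤ y + a} →
          c ≤ P.real (QuadConfig.crossedEvent Q)) →
      IsAdmissibleKernel P M → IsIsometryEquivariant M →
      (∀ ε : ℝ, 0 < ε → IsFlipFairKernel P (M ε)) → IsFlipExtremal P M →
      ∀ (t : ℝ) (ht : 0 < t), Measure.map (QuadConfig.dilate t ht.ne') P = P := by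
  sorry

/-- By-name handle of registered stub `Holds.stub_scaleInvariant`. -/
def stub_scaleInvariant : Prop := type_of% Holds.stub_scaleInvariant

/-- STUB 2 (load-bearing, open-problem; reshape 2, the uniqueness half of reshape-1's `stub_notMutuallySingular`) —
**non-singularity of two SCALE-INVARIANT models of the axioms**: two probability laws on `ℋ_ℂ`, each with (E2), (D),
(RSW), an admissible isometry-equivariant kernel family, (F) at every cutoff, (EXT), and each scale-invariant, are NOT
mutually singular (equivalently, by `eq_or_mutuallySingular`, equal). [cite: GarbanPeteSchramm2018, §7.1 and §11.1 (cut-off flip dynamics, reversibility); LastPenrose2017, Thm 4.1 (Mecke characterisation template)] -/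
protected theorem Holds.stub_notMutuallySingular_scaleInv :
    ∀ (P P' : Measure (QuadConfig (Set.univ : Set ℂ)))
      (M M' : ℝ → QuadConfig (Set.univ : Set ℂ) → Measure ℂ),
      IsProbabilityMeasure P → IsProbabilityMeasure P' →
      (∀ g : ℂ ≃ᵢ ℂ, Measure.map (QuadConfig.isometry g) P = P) →
      (∀ g : ℂ ≃ᵢ ℂ, Measure.map (QuadConfig.isometry g) P' = P') →
      (∀ (n : ℕ) (Q Qt : Fin n → Quad (Set.univ : Set ℂ)),
        (∀ i, (Qt i).carrier = (Q i).carrier ∧ (Qt i).side 0 = (Q i).side 1 ∧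
          (Qt i).side 1 = (Q i).side 2 ∧ (Qt i).side 2 = (Q i).side 3 ∧ (Qt i).side 3 = (Q i).side 0) →
        ∀ A : Set (Set (Fin n)), P {S | {i | Q i ∈ S} ∈ A} = P {S | {i | Qt i ∉ S} ∈ A}) →
      (∀ (n : ℕ) (Q Qt : Fin n → Quad (Set.univ : Set ℂ)),
        (∀ i, (Qt i).carrier = (Q i).carrier ∧ (Qt i).side 0 = (Q i).side 1 ∧
          (Qt i).side 1 = (Q i).side 2 ∧ (Qt i).side 2 = (Q i).side 3 ∧ (Qt i).side 3 = (Q i).side 0) →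
        ∀ A : Set (Set (Fin n)), P' {S | {i | Q i ∈ S} ∈ A} = P' {S | {i | Qt i ∉ S} ∈ A}) →
      (∃ c : ℝ, 0 < c ∧ ∀ (a x y : ℝ), 0 < a → ∀ Q : Quad (Set.univ : Set ℂ),
        Q.carrier = {w : ℂ | x ≤ w.re ∧ w.re ≤ x + 3 * a ∧ y ≤ w.im ∧ w.im ≤ y + a} →
        Q.side 0 = {w : ℂ | w.re = x ∧ y ≤ w.im ∧ w.im ≤ y + a} →
        Q.side 2 = {w : ℂ | w.re = x + 3 * a ∧ y ≤ w.im ∧ w.im ≤ y + a} →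
          c ≤ P.real (QuadConfig.crossedEvent Q)) →
      (∃ c : ℝ, 0 < c ∧ ∀ (a x y : ℝ), 0 < a → ∀ Q : Quad (Set.univ : Set ℂ),
        Q.carrier = {w : ℂ | x ≤ w.re ∧ w.re ≤ x + 3 * a ∧ y ≤ w.im ∧ w.im ≤ y + a} →
        Q.side 0 = {w : ℂ | w.re = x ∧ y ≤ w.im ∧ w.im ≤ y + a} →
        Q.side 2 = {w : ℂ | w.re = x + 3 * a ∧ y ≤ w.im ∧ w.im ≤ y + a} →
          c ≤ P'.real (QuadConfig.crossedEvent Q)) →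
      IsAdmissibleKernel P M → IsIsometryEquivariant M →
      (∀ ε : ℝ, 0 < ε → IsFlipFairKernel P (M ε)) → IsFlipExtremal P M →
      IsAdmissibleKernel P' M' → IsIsometryEquivariant M' →
      (∀ ε : ℝ, 0 < ε → IsFlipFairKernel P' (M' ε)) → IsFlipExtremal P' M' →
      (∀ (t : ℝ) (ht : 0 < t), Measure.map (QuadConfig.dilate t ht.ne') P = P) →
      (∀ (t : ℝ) (ht : 0 < t), Measure.map (QuadConfig.dilate t ht.ne') P' = P') →
      ¬ P ⟂ₘ P' := by
  sorry

/-- By-name handle of registered stub `Holds.stub_notMutuallySingular_scaleInv`. -/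
def stub_notMutuallySingular_scaleInv : Prop := type_of% Holds.stub_notMutuallySingular_scaleInv

/-- STUB 3 (XL; contains GPS's open ergodicity question on 𝕋) — **the Cardy model of the axioms exists**: some
probability law `P₀` on `ℋ_ℂ` with a kernel family `M₀` satisfies (E2), (D), (RSW), (ADM)+equivariance, (F),
(EXT) and gives every quad of a conformal rectangle its Cardy value.  Intended witness: the full-plane
quad-crossing law of the site-`𝕋` scaling limit with the Garban–Pete–Schramm `ε`-pivotal measures.
[cite: GarbanPeteSchramm2018, Thm 11.1 (reversibility) and §12.1 Remark (ergodicity open); GarbanPeteSchramm2013Pivotal, Thm 1.1 and §4 (pivotal measure); Smirnov2001, Thm 1 (Cardy on 𝕋); SchrammSmirnov2011, Cor. 5.2] -/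
protected theorem Holds.stub_cardyModel :
    ∃ (P : Measure (QuadConfig (Set.univ : Set ℂ))) (M : ℝ → QuadConfig (Set.univ : Set ℂ) → Measure ℂ),
      IsProbabilityMeasure P ∧
      (∀ g : ℂ ≃ᵢ ℂ, Measure.map (QuadConfig.isometry g) P = P) ∧
      (∀ (n : ℕ) (Q Qt : Fin n → Quad (Set.univ : Set ℂ)),
        (∀ i, (Qt i).carrier = (Q i).carrier ∧ (Qt i).side 0 = (Q i).side 1 ∧
          (Qt i).side 1 = (Q i).side 2 ∧ (Qt i).side 2 = (Q i).side 3 ∧ (Qt i).side 3 = (Q i).side 0) →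
        ∀ A : Set (Set (Fin n)), P {S | {i | Q i ∈ S} ∈ A} = P {S | {i | Qt i ∉ S} ∈ A}) ∧
      (∃ c : ℝ, 0 < c ∧ ∀ (a x y : ℝ), 0 < a → ∀ Q : Quad (Set.univ : Set ℂ),
        Q.carrier = {w : ℂ | x ≤ w.re ∧ w.re ≤ x + 3 * a ∧ y ≤ w.im ∧ w.im ≤ y + a} →
        Q.side 0 = {w : ℂ | w.re = x ∧ y ≤ w.im ∧ w.im ≤ y + a} →
        Q.side 2 = {w : ℂ | w.re = x + 3 * a ∧ y ≤ w.im ∧ w.im ≤ y + a} →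
          c ≤ P.real (QuadConfig.crossedEvent Q)) ∧
      IsAdmissibleKernel P M ∧ IsIsometryEquivariant M ∧
      (∀ ε : ℝ, 0 < ε → IsFlipFairKernel P (M ε)) ∧ IsFlipExtremal P M ∧
      (∀ (R : Literature.Probability.RandomPlanarGeometry.ConformalRectangle)
        (φ : Literature.Probability.RandomPlanarGeometry.ConformalEquiv UpperHalfPlane.upperHalfPlaneSet R.carrier)
        (x : Fin 4 → ℝ), R.IsUniformizing φ x → ∀ Q : Quad (Set.univ : Set ℂ),
          Q.carrier = closure R.carrier → Q.side 0 = R.arc 0 → Q.side 1 = R.arc 1 → Q.side 2 = R.arc 2 →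
          Q.side 3 = R.arc 3 →
            P.real (QuadConfig.crossedEvent Q) =
              Literature.Probability.RandomPlanarGeometry.cardyFunction
                (Literature.Probability.RandomPlanarGeometry.crossRatio x)) := by
  sorry

/-- By-name handle of registered stub `Holds.stub_cardyModel`. -/
def stub_cardyModel : Prop := type_of% Holds.stub_cardyModel

/-! ### The assembly (sorry-free): the three stubs imply the crux BY NAME -/

/-- **Skeleton theorem (reshape 2).** `stub_scaleInvariant → stub_notMutuallySingular_scaleInv → stub_cardyModel →
MeckeRigidity`: identify the characterised parameter `Piv` with `QuadConfig.IsPivotalAt`, rebundle the inlined clauses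
(ADM)/(F)/(EXT) into the named predicates of `FlipFairKernel.lean`, take the Cardy model `(P₀, M₀)`, obtain scale
invariance of `P` and of `P₀` from the first stub, and apply the landed EQUAL-OR-SINGULAR dichotomy to `(P, P₀)`: the
singular branch is excluded by the second stub, so `P = P₀` and Cardy's values are read off the model. [folklore] -/
theorem MeckeRigidity_of :
    stub_scaleInvariant → stub_notMutuallySingular_scaleInv → stub_cardyModel →
      Summit.CriticalPhenomena.CardyFormulaZ2.Theses.CardyMeckeFlip.MeckeRigidity := by
  intro hS hU hE Piv hPiv P M hprob hE2 hD c hc hRSW hADM hF hEXT R φ x hφx Q hQc h0 h1 h2 h3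
  -- (1) the characterised parameter IS the named pivotal predicate
  obtain rfl : Piv = fun S x Q => S.IsPivotalAt x Q := QuadConfig.eq_isPivotalAt_of_forall_iff hPiv
  -- (2) the Cardy model of the axioms
  obtain ⟨P₀, M₀, hprob₀, hE2₀, hD₀, hRSW₀, hADM₀, hEqv₀, hF₀, hEXT₀, hCardy₀⟩ := hE
  -- (3) rebundle the inlined clauses of the crux into the named predicates
  have hAE : IsAdmissibleKernel P M ∧ IsIsometryEquivariant M :=
    (isAdmissibleKernel_and_isIsometryEquivariant_iff P M).2 hADM
  have hF' : ∀ ε : ℝ, 0 < ε → IsFlipFairKernel P (M ε) := fun ε hε => hF ε hε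
  have hEXT' : IsFlipExtremal P M := hEXT
  -- (4) both laws are scale-invariant
  have hSP : ∀ (t : ℝ) (ht : 0 < t), Measure.map (QuadConfig.dilate t ht.ne') P = P :=
    hS P M hprob hE2 hD ⟨c, hc, hRSW⟩ hAE.1 hAE.2 hF' hEXT'
  have hSP₀ : ∀ (t : ℝ) (ht : 0 < t), Measure.map (QuadConfig.dilate t ht.ne') P₀ = P₀ :=
    hS P₀ M₀ hprob₀ hE2₀ hD₀ hRSW₀ hADM₀ hEqv₀ hF₀ hEXT₀
  -- (5) equal or singular; singular is excluded by the stub, so `P = P₀`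
  have hns : ¬ P ⟂ₘ P₀ := hU P P₀ M M₀ hprob hprob₀ hE2 hE2₀ hD hD₀ ⟨c, hc, hRSW⟩ hRSW₀ hAE.1 hAE.2 hF' hEXT'
    hADM₀ hEqv₀ hF₀ hEXT₀ hSP hSP₀
  rcases Summit.CriticalPhenomena.CardyFormulaZ2.Theorems.CardyMeckeFlip.eq_or_mutuallySingular
    hE2 hE2₀ hAE.1 hADM₀ hF' hF₀ hEXT' hEXT₀ with heq | hsing
  · subst heq
    exact hCardy₀ R φ x hφx Q hQc h0 h1 h2 h3
  · exact (hns hsing).elim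

end Summit.CriticalPhenomena.CardyFormulaZ2.Cruxes.MeckeRigidity.Birth

end
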